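import Literature.GroupTheory.CombinatorialGroupTheory.RandomSclFreeGroupProofs
import HarnessLib

/-!
# Random rigidity of scl (Calegari–Walker 2013): proofs, part 11 — equidistribution of chunk types

D. Calegari, A. Walker, *Random rigidity in the free group*, Geom. Topol. 17 (2013)
[CalegariWalker2013], §2.3–§2.4 (Prop. 2.3, Lemma 2.5) and §4.3: the subwords of a random reduced
word at the positions of a grid are almost equidistributed among the reduced words of their
length, so that almost all of them can be matched in inverse pairs.

We cut a word of length `n` into consecutive chunks of length `ℓ + 1` starting at position `1`,
`C_j = w[1 + j(ℓ+1), (j+1)(ℓ+1)]`, and control the number `c σ` of chunks of each type `σ`: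

* **`chunk_ne_inv`** — a chunk of a reduced word is never its own inverse word.
* **`discrepancy_le`** — (deterministic) if every type count is `≤ U` then the matching
  discrepancy `∑_{σ occurring} (c σ − c σ⁻¹)₊` is at most `|𝒯| · U − J`, `𝒯 ⊇` the set of
  possible types (closed under inversion), `J` the number of chunks: only UPPER bounds on the
  counts are needed.
* **`window_mem_reducedWords`**, **`invWord_mem_reducedWords`** — chunks of reduced words and
  inverse words of reduced words are reduced.

The probabilistic input (Lemma 2.5 for the odd-numbered and the even-numbered chunks, the
previous chunk playing the role of the gap) and the assembly are in `RandomSclFreeGroupUpperTail`.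
-/

noncomputable section

open Filter

namespace Literature.GroupTheory.CombinatorialGroupTheory

section ChunkTypes

open scoped Classical

/-- **A chunk of a reduced word is not its own inverse.** For `w` reduced and a window
`w[p, p + ℓ]`: it differs from its inverse word (at the middle letter, or at the two middle
letters, which would cancel). [folklore] -/
theorem chunk_ne_inv {k n ℓ p : ℕ} {w : Fin n → Fin k × Bool} (hw : w ∈ reducedWords k n)
    (hp : p + ℓ < n) :
    (fun q : Fin (ℓ + 1) => w ⟨p + q, by omega⟩) ≠
      fun q : Fin (ℓ + 1) => ((w ⟨p + (ℓ - q), by omega⟩).1, !(w ⟨p + (ℓ - q), by omega⟩).2) := by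
  intro h
  rw [mem_reducedWords_iff, reduce_ofFn_eq_self_iff] at hw
  rcases Nat.even_or_odd ℓ with ⟨m, hm⟩ | ⟨m, hm⟩
  · -- even length `ℓ = 2m`: the middle letter would be its own inverse
    have h1 := congrFun h ⟨m, by omega⟩
    simp only at h1
    have e : (⟨p + (ℓ - m), by omega⟩ : Fin n) = ⟨p + m, by omega⟩ := Fin.ext (by simp only; omega)
    rw [e] at h1
    have h2' := congrArg Prod.snd h1
    have h2 : (w ⟨p + m, by omega⟩).2 = !(w ⟨p + m, by omega⟩).2 := h2'
    exact (Bool.eq_not_self _).mp h2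
  · -- odd length `ℓ = 2m + 1`: the two middle letters would cancel
    have h1 := congrFun h ⟨m, by omega⟩
    simp only at h1
    have e : (⟨p + (ℓ - m), by omega⟩ : Fin n) = ⟨p + m + 1, by omega⟩ := Fin.ext (by simp only; omega)
    rw [e] at h1
    have h3' := congrArg Prod.fst h1
    have h3 : (w ⟨p + m, by omega⟩).1 = (w ⟨p + m + 1, by omega⟩).1 := h3'
    have h4 := hw (p + m) (by omega) h3
    have h5' := congrArg Prod.snd h1
    have h5 : (w ⟨p + m, by omega⟩).2 = !(w ⟨p + m + 1, by omega⟩).2 := h5'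
    rw [h4] at h5
    exact (Bool.eq_not_self _).mp h5

/-- **The matching discrepancy from upper bounds only.** Let `typ : Fin J → X` (the types of `J`
chunks), `ι : X → X` an involution, `𝒯` a finite set of types closed under `ι` and containing all
the `typ j`, and suppose every count `c σ = #{j : typ j = σ}` (`σ ∈ 𝒯`) is `≤ U`. Then
`∑_{σ ∈ image typ} (c σ − c (ι σ))₊ ≤ |𝒯| U − J`. [folklore] -/
theorem discrepancy_le {X : Type*} [DecidableEq X] {J : ℕ} (typ : Fin J → X) (ι : X → X)
    (hι : ∀ σ, ι (ι σ) = σ) (𝒯 : Finset X) (h𝒯 : ∀ j, typ j ∈ 𝒯) (hι𝒯 : ∀ σ ∈ 𝒯, ι σ ∈ 𝒯)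
    (U : ℕ) (hU : ∀ σ ∈ 𝒯, (Finset.univ.filter fun j : Fin J => typ j = σ).card ≤ U) :
    ∑ σ ∈ (Finset.univ : Finset (Fin J)).image typ,
        ((Finset.univ.filter fun j : Fin J => typ j = σ).card -
          (Finset.univ.filter fun j : Fin J => typ j = ι σ).card) + J ≤ 𝒯.card * U := by
  set c : X → ℕ := fun σ => (Finset.univ.filter fun j : Fin J => typ j = σ).card with hc
  -- `∑_{𝒯} c (ι σ) = ∑_{𝒯} c σ = J`
  have hsum : ∑ σ ∈ 𝒯, c σ = J := by
    have := Finset.card_eq_sum_card_fiberwise (s := (Finset.univ : Finset (Fin J))) (t := 𝒯)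
      (f := typ) (fun j _ => h𝒯 j)
    rw [Finset.card_univ, Fintype.card_fin] at this
    exact this.symm
  have hsumι : ∑ σ ∈ 𝒯, c (ι σ) = J := by
    rw [← hsum]
    exact Finset.sum_nbij' ι ι (fun σ hσ => hι𝒯 σ hσ) (fun σ hσ => hι𝒯 σ hσ)
      (fun σ _ => hι σ) (fun σ _ => hι σ) (fun σ _ => rfl)
  -- extend the sum to `𝒯` and bound termwise by `U - c (ι σ)`
  have hsub : (Finset.univ : Finset (Fin J)).image typ ⊆ 𝒯 := by
    intro σ hσ
    rw [Finset.mem_image] at hσ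
    obtain ⟨j, _, rfl⟩ := hσ
    exact h𝒯 j
  have h1 : ∑ σ ∈ (Finset.univ : Finset (Fin J)).image typ, (c σ - c (ι σ)) ≤
      ∑ σ ∈ 𝒯, (c σ - c (ι σ)) :=
    Finset.sum_le_sum_of_subset_of_nonneg hsub fun _ _ _ => Nat.zero_le _
  have h2 : ∑ σ ∈ 𝒯, (c σ - c (ι σ)) ≤ ∑ σ ∈ 𝒯, (U - c (ι σ)) :=
    Finset.sum_le_sum fun σ hσ => Nat.sub_le_sub_right (hU σ hσ) _
  have h3 : ∑ σ ∈ 𝒯, (U - c (ι σ)) + ∑ σ ∈ 𝒯, c (ι σ) ≤ 𝒯.card * U := by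
    rw [← Finset.sum_add_distrib]
    calc ∑ σ ∈ 𝒯, (U - c (ι σ) + c (ι σ)) ≤ ∑ _σ ∈ 𝒯, U :=
          Finset.sum_le_sum fun σ hσ => by
            have hle : c (ι σ) ≤ U := hU (ι σ) (hι𝒯 σ hσ)
            show U - c (ι σ) + c (ι σ) ≤ U
            omega
      _ = 𝒯.card * U := by rw [Finset.sum_const, smul_eq_mul]
  rw [hsumι] at h3
  show ∑ σ ∈ (Finset.univ : Finset (Fin J)).image typ, (c σ - c (ι σ)) + J ≤ 𝒯.card * U
  omega

/-- **Windows of reduced words are reduced.** [folklore] -/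
theorem window_mem_reducedWords {k n ℓ p : ℕ} {w : Fin n → Fin k × Bool}
    (hw : w ∈ reducedWords k n) (hp : p + ℓ < n) :
    (fun q : Fin (ℓ + 1) => w ⟨p + q, by omega⟩) ∈ reducedWords k (ℓ + 1) := by
  rw [mem_reducedWords_iff, reduce_ofFn_eq_self_iff] at hw ⊢
  intro i hi h1
  exact hw (p + i) (by omega) h1

/-- **The inverse word of a reduced word is reduced.** [folklore] -/
theorem invWord_mem_reducedWords {k ℓ : ℕ} {σ : Fin (ℓ + 1) → Fin k × Bool}
    (hσ : σ ∈ reducedWords k (ℓ + 1)) :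
    (fun q : Fin (ℓ + 1) => ((σ ⟨ℓ - q, by omega⟩).1, !(σ ⟨ℓ - q, by omega⟩).2)) ∈
      reducedWords k (ℓ + 1) := by
  rw [mem_reducedWords_iff, reduce_ofFn_eq_self_iff] at hσ ⊢
  intro i hi h1
  simp only at h1 ⊢
  rw [Bool.not_inj_iff]
  have e1 : (⟨ℓ - i, by omega⟩ : Fin (ℓ + 1)) = ⟨ℓ - (i + 1) + 1, by omega⟩ := Fin.ext (by simp only; omega)
  rw [e1] at h1 ⊢
  exact (hσ (ℓ - (i + 1)) (by omega) h1.symm).symm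

end ChunkTypes

end Literature.GroupTheory.CombinatorialGroupTheory

end
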